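/-
R90-TF · S1 «Ch. 10∕12 local» — U4Keys leaf at a TAME RAMIFIED place, BRANCH B, brick (B-10)(6b) PART 1 FILE 2: THE ODD SKEW-LINE FIBRES REDUCE TO THE LEVEL-ONE SKEW SPHERE.
Prover seat hodgecm-mathlib-R90-C10-p07 (g2); helper lane `--supports stmt-HodgeConjecture-24833 --as helper`; closes NO socket.
-/
import Summits.HodgeConjecture.HodgeConjecture.Theorems.R90S1BposRamShellFibres   -- ★ (6b) PART 1 FILE 1 (this seat): `setIntegral_shellFibre_eq_scale_ram`, the `l`-letters, parity of the skew line
import HarnessLib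

/-!
# R90 · S1 ∕ U4Keys leaf (U4f-χ₁-ram-one-pos), BRANCH B AT A TAME RAMIFIED PLACE — brick (B-10)(6b) PART 1 FILE 2: THE ODD FIBRES
# `∫_{|a+y|_w = e^{2κ+1}} F₀(a+y) dμ⁻ = X^{κ+1}·q^{−(κ+1)}·∫_{|s|_w = e⁻¹} F₀(l^{κ+1}a+s) dμ⁻` (`|a|_w < e^{2κ+1}`) and `= 0` (`|a|_w > e^{2κ+1}`)
# [Keys1984 §4, §7 Thm (2) (d); Rogawski1990 §1.10, §12.2 (2); WeilBNT1967 Ch. II §5]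

Cell `pub/hodgecm-mathlib` (D-0151), SLAB R90-TF, section S1 «Ch. 10∕12 local», crux H413 = `stmt-HodgeConjecture-24833` (lane `--supports … --as helper`), route of record
`HCCMUnconditional` (no route verbs); prover seat `hodgecm-mathlib-R90-C10-p07` (g2); census `R90/R90-C10-p07/g2/CENSUS-B10-6b-RamShells.R90-C10-p07-g2.md` 851bc30f32e5421c §3
«ODD FIBRES REDUCE» (pushed out of FILE 1 ★ `R90S1BposRamShellFibres` by the 400-line cap).  THEOREMS ONLY (no `def`, no `instance`, no notation, no named-fact hypothesis, no `sorry`);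
★-only imports.  NOT THE PAYER of :182.

FRAME = FILE 1 (= ★ (B-5b)): `R := LocalRing L v` at a NON-SPLIT place (`w`, `hw`), TAME RAMIFIED (`he : e(w|v) ≠ 1`, `h2w : |2|_w = 1`); `σ := conjLocal L c v`, `R⁻ := HeisRing.skewPart σ`,
`μ⁻ = μY` a regular additive Haar measure on `R⁻`; `F₀` = ★ (B-5b)'s inline `dite` BYTE FOR BYTE; the scaling unit is the LETTER `l : Rˣ` (`hlσ`, `hlv : |l_w| = exp(−2)`, `hlm : ‖l‖_R = (q²)⁻¹`)
of FILE 1 §0 (ONE-CURRENCY `l := Units.map σ piU * piU`, `X := χ₁ l`).  The level-one SPHERE is spelled `{s : R⁻ | Valued.v ((s : R) w) = WithZero.exp (-1)}` (ϖ-free; agreed with (6a)).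
* §1 PARITY AND POSITION: a `σ`-fixed `a` has `|a_w| ≠ exp(2κ+1)` and `|a_w| < exp(2κ+1) → |a_w| ≤ exp(2κ)` (fixed = even order ★ `RamifiedPlaceFixedValuationParity`); since `|a + y|_w =
  max(|a_w|, |y_w|)` (★ `valued_fixed_add_skew_eq_max_ram`): `exp j < |a_w|` ⇒ the fibre `{y : R⁻ | |a + y|_w = exp j}` is EMPTY, `|a_w| < exp j` ⇒ it IS the sphere `{|y_w| = exp j}`.
* §2 THE SCALED BASE `l^{κ+1}·a`: `σ`-fixed, `|l^{κ+1}a|_w = exp(−2(κ+1))·|a_w|`, and `< exp(−1)`, `≤ exp(−2)` when `|a_w| < exp(2κ+1)` — the letters (6a) `R90S1BposRamGaussSphere` takes for its base.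
* §3 THE ODD FIBRES (`κ : ℕ`): **`∫_{|a+y|_w = exp(2κ+1)} F₀(a+y) dμ⁻ = X^{κ+1}·(q⁻¹)^{κ+1}·∫_{|s|_w = exp(−1)} F₀(l^{κ+1}a + s) dμ⁻`** when `|a_w| < exp(2κ+1)` (FILE 1 §2 at `t = κ+1`, then
  §1 on the scaled base), and `∫_{|a+y|_w = exp j} g dμ⁻ = 0` for ANY integrand when `exp j < |a_w|`.  With FILE 1 §3 (even fibres vanish) every fibre of the ramified positive-depth
  Casselman pair over a `σ`-fixed base is now `0` or an explicit multiple of the level-one sphere integral `J(a′) := ∫_{|s|_w = exp(−1)} F₀(a′ + s) dμ⁻`, `a′ := l^{κ+1}a`.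
* §4 THE BASE OF THE CUT-OFF SHELLS `a(x) := −(x·σx)·c` (★ `R90S1BposRamCutoffShells`∕`R90S1BposCutoffShellIntegral` letters, `σc = c`, `|c_w| = 1`, e.g. `c = ⅟2`): `σ`-fixed with
  `|a(x)_w| = |x_w|·|x_w|` — so (6c) reads the rows `A j`, `B j`, `0` off §3 + (6a) (G1)–(G4) + FILE 1 §3 with no further geometry.
HONEST LABEL.  HC_CM is proved only modulo the 7 printed citations (2 remaining named inputs: hLiu418 = `stmt-HodgeConjecture-24832`, h413 = `stmt-HodgeConjecture-24833`) until rung 0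
closes; count-neutral — this file does NOT pay :182 (nor :155, nor A2′); no printed citation is discharged; REL ≠ ★ ≠ BUILT.

## References
* [Keys1984] D. Keys, *Principal series representations of special unitary groups over local fields*, Compositio Math. 51 (1984), §4, §7 Theorem (2) (d) p. 126.
* [Rogawski1990] J. D. Rogawski, *Automorphic Representations of Unitary Groups in Three Variables*, Ann. of Math. Stud. 123 (1990), §1.10 p. 9, §12.2 (2) p. 173.
* [WeilBNT1967] A. Weil, *Basic Number Theory* (1967), Ch. I §2, Ch. II §5.
-/

set_option autoImplicit false
-- the mandated namespace has the single-problem summit's repeated segment (`HodgeConjecture.HodgeConjecture`)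
set_option linter.dupNamespace false

noncomputable section

open NumberField IsDedekindDomain MeasureTheory Measure Topology Set
open scoped NNReal ENNReal
open Literature.NumberTheory Literature.NumberTheory.Automorphic Literature.NumberTheory.Automorphic.UnitaryGroup

namespace Summit.HodgeConjecture.HodgeConjecture.R90.S1.BposRamShellFibresOdd

open Summit.HodgeConjecture.HodgeConjecture.Cruxes.H413
open Summit.HodgeConjecture.HodgeConjecture.R90.S1
open Summit.HodgeConjecture.HodgeConjecture.R90.S1.BposRamShellFibres
open Literature.NumberTheory.LocalFields.RamifiedPlaceFixedValuationParity

variable (L : Type) [Field L] [NumberField L] [IsCMField L] (v : HeightOneSpectrum (𝓞 ↥(maximalRealSubfield L)))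
  (w : PlacesOver L v) (hw : IsCMField.complexConj L • w.1 = w.1)

/-! ## §1 Parity of a `σ`-fixed base and its position against a level -/
include hw in
/-- FIXED = EVEN ORDER: a `σ`-fixed `a` never sits on an odd level, `|a_w| ≠ exp(2κ+1)` (★ `even_log_valued_of_complexConj_eq_self`). [cite: Rogawski1990, §1.10 p. 9] -/
theorem valued_fixed_ne_exp_odd_ram (he : v.asIdeal.ramificationIdx' w.1.asIdeal ≠ 1)
    {a : LocalRing L v} (ha : conjLocal L (IsCMField.complexConj L) v a = a) (κ : ℤ) :
    Valued.v (a w) ≠ WithZero.exp (2 * κ + 1) := by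
  haveI : Algebra.IsQuadraticExtension ↥(maximalRealSubfield L) L := IsCMField.isQuadraticExtension L
  intro h
  by_cases ha0 : a w = 0
  · rw [ha0, map_zero] at h; exact WithZero.exp_ne_zero h.symm
  · have hσa : galAdicCompletionMap (L := L) (IsCMField.complexConj L) hw (a w) = a w := by
      rw [← conjLocal_apply_eq_of_smul_eq (IsCMField.complexConj L) (IsCMField.complexConj_ne_one L) v w hw, ha]
    obtain ⟨m, hm⟩ := even_log_valued_of_complexConj_eq_self L w hw he ha0 hσa
    have hlog := congrArg WithZero.log h
    rw [WithZero.log_exp, hm] at hlog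
    omega
include hw in
/-- FIXED = EVEN ORDER, rounded down: `|a_w| < exp(2κ+1) → |a_w| ≤ exp(2κ)` for a `σ`-fixed `a`. [cite: Rogawski1990, §1.10 p. 9] -/
theorem valued_fixed_le_exp_of_lt_exp_odd_ram (he : v.asIdeal.ramificationIdx' w.1.asIdeal ≠ 1)
    {a : LocalRing L v} (ha : conjLocal L (IsCMField.complexConj L) v a = a) (κ : ℤ) (h : Valued.v (a w) < WithZero.exp (2 * κ + 1)) :
    Valued.v (a w) ≤ WithZero.exp (2 * κ) := by
  haveI : Algebra.IsQuadraticExtension ↥(maximalRealSubfield L) L := IsCMField.isQuadraticExtension L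
  by_cases ha0 : a w = 0
  · rw [ha0, map_zero]; exact zero_le
  · have hσa : galAdicCompletionMap (L := L) (IsCMField.complexConj L) hw (a w) = a w := by
      rw [← conjLocal_apply_eq_of_smul_eq (IsCMField.complexConj L) (IsCMField.complexConj_ne_one L) v w hw, ha]
    obtain ⟨m, hm⟩ := even_log_valued_of_complexConj_eq_self L w hw he ha0 hσa
    have hv0 : Valued.v (a w) ≠ 0 := (Valuation.ne_zero_iff _).2 ha0
    rw [← WithZero.exp_log hv0, hm] at h ⊢
    rw [WithZero.exp_lt_exp] at h
    rw [WithZero.exp_le_exp]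
    omega
include hw in
/-- **THE FIBRE ABOVE THE BASE IS EMPTY**: for a `σ`-fixed `a`, a skew `y` and `exp j < |a_w|`, `|a + y|_w = max(|a_w|, |y_w|) ≥ |a_w| > exp j` (★ `valued_fixed_add_skew_eq_max_ram`), so
`{y ∈ R⁻ : |a + y|_w = exp j} = ∅`. [cite: Rogawski1990, §1.10 p. 9] [cite: WeilBNT1967, Ch. II §5] -/
theorem shellFibre_eq_empty_of_exp_lt_ram (he : v.asIdeal.ramificationIdx' w.1.asIdeal ≠ 1) (h2w : Valued.v (2 : w.1.adicCompletion L) = 1)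
    {a : LocalRing L v} (ha : conjLocal L (IsCMField.complexConj L) v a = a) {j : ℤ} (hj : WithZero.exp j < Valued.v (a w)) :
    {y : ↥(HeisRing.skewPart (conjLocal L (IsCMField.complexConj L) v)) | Valued.v ((a + (y : LocalRing L v)) w) = WithZero.exp j} = ∅ := by
  haveI : Algebra.IsQuadraticExtension ↥(maximalRealSubfield L) L := IsCMField.isQuadraticExtension L
  have hσa : galAdicCompletionMap (L := L) (IsCMField.complexConj L) hw (a w) = a w := by
    rw [← conjLocal_apply_eq_of_smul_eq (IsCMField.complexConj L) (IsCMField.complexConj_ne_one L) v w hw, ha]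
  ext y
  simp only [mem_setOf_eq, mem_empty_iff_false, iff_false]
  have hσy : galAdicCompletionMap (L := L) (IsCMField.complexConj L) hw ((y : LocalRing L v) w) = -((y : LocalRing L v) w) := by
    rw [← conjLocal_apply_eq_of_smul_eq (IsCMField.complexConj L) (IsCMField.complexConj_ne_one L) v w hw, (HeisRing.mem_skewPart_iff _ _).1 y.2, Pi.neg_apply]
  rw [Pi.add_apply, valued_fixed_add_skew_eq_max_ram L w hw he h2w hσa hσy]
  exact (lt_of_lt_of_le hj (le_max_left _ _)).ne'
include hw in
/-- **THE FIBRE BELOW THE BASE IS THE SPHERE**: for a `σ`-fixed `a` with `|a_w| < exp j`, `{y ∈ R⁻ : |a + y|_w = exp j} = {y ∈ R⁻ : |y_w| = exp j}` (`|a + y|_w = max(|a_w|, |y_w|)`).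
[cite: Rogawski1990, §1.10 p. 9] [cite: WeilBNT1967, Ch. II §5] -/
theorem shellFibre_eq_sphere_of_lt_exp_ram (he : v.asIdeal.ramificationIdx' w.1.asIdeal ≠ 1) (h2w : Valued.v (2 : w.1.adicCompletion L) = 1)
    {a : LocalRing L v} (ha : conjLocal L (IsCMField.complexConj L) v a = a) {j : ℤ} (hj : Valued.v (a w) < WithZero.exp j) :
    {y : ↥(HeisRing.skewPart (conjLocal L (IsCMField.complexConj L) v)) | Valued.v ((a + (y : LocalRing L v)) w) = WithZero.exp j} =
      {y : ↥(HeisRing.skewPart (conjLocal L (IsCMField.complexConj L) v)) | Valued.v ((y : LocalRing L v) w) = WithZero.exp j} := by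
  haveI : Algebra.IsQuadraticExtension ↥(maximalRealSubfield L) L := IsCMField.isQuadraticExtension L
  have hσa : galAdicCompletionMap (L := L) (IsCMField.complexConj L) hw (a w) = a w := by
    rw [← conjLocal_apply_eq_of_smul_eq (IsCMField.complexConj L) (IsCMField.complexConj_ne_one L) v w hw, ha]
  ext y
  simp only [mem_setOf_eq]
  have hσy : galAdicCompletionMap (L := L) (IsCMField.complexConj L) hw ((y : LocalRing L v) w) = -((y : LocalRing L v) w) := by
    rw [← conjLocal_apply_eq_of_smul_eq (IsCMField.complexConj L) (IsCMField.complexConj_ne_one L) v w hw, (HeisRing.mem_skewPart_iff _ _).1 y.2, Pi.neg_apply]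
  rw [Pi.add_apply, valued_fixed_add_skew_eq_max_ram L w hw he h2w hσa hσy]
  constructor
  · intro h
    rcases le_total (Valued.v (a w)) (Valued.v ((y : LocalRing L v) w)) with hle | hle
    · rwa [max_eq_right hle] at h
    · rw [max_eq_left hle] at h
      exact absurd h hj.ne
  · intro h
    rw [h]
    exact max_eq_right hj.le

/-! ## §2 The scaled base `l^{κ+1}·a`: `σ`-fixed, of level `< exp(−1)` (indeed `≤ exp(−2)`) when `|a_w| < exp(2κ+1)` -/
/-- `σ(lᵗ·a) = lᵗ·a` for a `σ`-fixed unit `l` and a `σ`-fixed `a`. [cite: Rogawski1990, §1.10 p. 9] -/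
theorem conjLocal_units_pow_mul_of_fixed (l : (LocalRing L v)ˣ) (hlσ : conjLocal L (IsCMField.complexConj L) v (l : LocalRing L v) = l)
    {a : LocalRing L v} (ha : conjLocal L (IsCMField.complexConj L) v a = a) (t : ℕ) :
    conjLocal L (IsCMField.complexConj L) v ((((l ^ t : (LocalRing L v)ˣ)) : LocalRing L v) * a) = (((l ^ t : (LocalRing L v)ˣ)) : LocalRing L v) * a := by
  rw [map_mul, conjLocal_units_pow L v l hlσ t, ha]
omit [IsCMField L] in
/-- `|(lᵗ·a)_w|_w = (exp 2t)⁻¹·|a_w|_w` for a unit `l` with `|l_w|_w = exp(−2)`. [cite: WeilBNT1967, Ch. I §2] -/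
theorem valued_units_pow_mul_apply_ram (l : (LocalRing L v)ˣ) (hlv : Valued.v ((l : LocalRing L v) w) = WithZero.exp (-2 : ℤ)) (a : LocalRing L v) (t : ℕ) :
    Valued.v (((((l ^ t : (LocalRing L v)ˣ)) : LocalRing L v) * a) w) = (WithZero.exp ((2 * t : ℕ) : ℤ))⁻¹ * Valued.v (a w) := by
  rw [Pi.mul_apply, map_mul, valued_pow_apply_of_valued_eq L v w l hlv t]
include hw in
/-- **THE SCALED BASE SITS STRICTLY BELOW THE LEVEL-ONE SPHERE**: for a `σ`-fixed `a` with `|a_w| < exp(2κ+1)` and a `σ`-fixed unit `l` with `|l_w| = exp(−2)`,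
`|(l^{κ+1}a)_w| < exp(−1)` and (parity) `|(l^{κ+1}a)_w| ≤ exp(−2)` — the base letters of (6a)'s level-one sphere integral `J(l^{κ+1}a)`. [cite: Rogawski1990, §1.10 p. 9, §12.2 (2) p. 173] -/
theorem valued_units_pow_succ_mul_fixed_ram (he : v.asIdeal.ramificationIdx' w.1.asIdeal ≠ 1)
    (l : (LocalRing L v)ˣ) (hlσ : conjLocal L (IsCMField.complexConj L) v (l : LocalRing L v) = l) (hlv : Valued.v ((l : LocalRing L v) w) = WithZero.exp (-2 : ℤ))
    {a : LocalRing L v} (ha : conjLocal L (IsCMField.complexConj L) v a = a) (κ : ℕ) (h : Valued.v (a w) < WithZero.exp (2 * (κ : ℤ) + 1)) :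
    Valued.v (((((l ^ (κ + 1) : (LocalRing L v)ˣ)) : LocalRing L v) * a) w) < WithZero.exp (-1 : ℤ) ∧
      Valued.v (((((l ^ (κ + 1) : (LocalRing L v)ˣ)) : LocalRing L v) * a) w) ≤ WithZero.exp (-2 : ℤ) := by
  have hfix := conjLocal_units_pow_mul_of_fixed L v l hlσ ha (κ + 1)
  have hlt : Valued.v (((((l ^ (κ + 1) : (LocalRing L v)ˣ)) : LocalRing L v) * a) w) < WithZero.exp (-1 : ℤ) := by
    rw [valued_units_pow_mul_apply_ram L v w l hlv a (κ + 1)]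
    by_cases ha0 : a w = 0
    · rw [ha0, map_zero, mul_zero]; exact WithZero.pos_iff_ne_zero.2 WithZero.exp_ne_zero
    · have hv0 : Valued.v (a w) ≠ 0 := (Valuation.ne_zero_iff _).2 ha0
      have hle := valued_fixed_le_exp_of_lt_exp_odd_ram L v w hw he ha κ h
      rw [← WithZero.exp_log hv0] at hle ⊢
      rw [WithZero.exp_le_exp] at hle
      rw [← WithZero.exp_neg, ← WithZero.exp_add, WithZero.exp_lt_exp]
      push_cast
      omega
  have h1 : (2 * (-1 : ℤ) + 1) = -1 := by norm_num
  have h2 : (2 * (-1 : ℤ)) = -2 := by norm_num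
  have hle2 := valued_fixed_le_exp_of_lt_exp_odd_ram L v w hw he hfix (-1)
  rw [h1, h2] at hle2
  exact ⟨hlt, hle2 hlt⟩

/-! ## §3 THE ODD FIBRES: `0` above the base, `X^{κ+1}·q^{−(κ+1)}·(level-one sphere integral at the scaled base)` below it -/
section OddFibre
variable [MeasurableSpace (LocalRing L v)] [BorelSpace (LocalRing L v)]
  (μY : Measure ↥(HeisRing.skewPart (conjLocal L (IsCMField.complexConj L) v)))
omit [BorelSpace (LocalRing L v)] in
include hw in
/-- **THE FIBRE ABOVE THE BASE CARRIES NOTHING**: for a `σ`-fixed `a` with `exp j < |a_w|` the region `{y ∈ R⁻ : |a + y|_w = exp j}` is empty (§1), so `∫_{|a+y|_w = exp j} g dμ⁻ = 0` for EVERY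
integrand `g` and every measure. [cite: Rogawski1990, §1.10 p. 9] [cite: WeilBNT1967, Ch. II §5] -/
theorem setIntegral_shellFibre_eq_zero_of_exp_lt_ram (he : v.asIdeal.ramificationIdx' w.1.asIdeal ≠ 1) (h2w : Valued.v (2 : w.1.adicCompletion L) = 1)
    {a : LocalRing L v} (ha : conjLocal L (IsCMField.complexConj L) v a = a) {j : ℤ} (hj : WithZero.exp j < Valued.v (a w))
    (g : ↥(HeisRing.skewPart (conjLocal L (IsCMField.complexConj L) v)) → ℂ) :
    ∫ y in {y : ↥(HeisRing.skewPart (conjLocal L (IsCMField.complexConj L) v)) | Valued.v ((a + (y : LocalRing L v)) w) = WithZero.exp j}, g y ∂μY = 0 := by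
  rw [shellFibre_eq_empty_of_exp_lt_ram L v w hw he h2w ha hj, Measure.restrict_empty, integral_zero_measure]
variable [μY.IsAddHaarMeasure] [μY.Regular]
open scoped Classical in
include hw in
/-- **THE ODD FIBRE REDUCES TO THE LEVEL-ONE SKEW SPHERE.**  Tame ramified non-split `w ∣ v` (`he`, `|2|_w = 1`), `l` a `σ`-fixed unit with `|l_w| = exp(−2)`, `‖l‖_R = (q²)⁻¹` (`X := χ₁ l`;
FILE 1 §0 discharges these for `l = σΠ̂·Π̂`), `μ⁻` a regular additive Haar measure on `R⁻`, `a` `σ`-FIXED with `|a_w| < exp(2κ+1)` (`κ : ℕ`).  THEN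
**`∫_{y ∈ R⁻ : |a + y|_w = exp(2κ+1)} F₀(a + y) dμ⁻ = X^{κ+1} · (q⁻¹)^{κ+1} · ∫_{s ∈ R⁻ : |s_w| = exp(−1)} F₀(l^{κ+1}a + s) dμ⁻`** — FILE 1 §2 (`setIntegral_shellFibre_eq_scale_ram`) at `t = κ+1`
moves the fibre to level `exp(2κ+1 − 2(κ+1)) = exp(−1)` over the scaled base `l^{κ+1}a`, which is `σ`-fixed of level `< exp(−1)` (§2), so that fibre IS the level-one sphere (§1).  The last
integral is the `J(l^{κ+1}a)` that ★ (5) `R90S1BposRamSkewLineCayley` (cosets) and (6a) `R90S1BposRamGaussSphere` (G1)–(G4) evaluate.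
[cite: Keys1984, §4, §7 Theorem (2) (d) p. 126] [cite: Rogawski1990, §12.2 (2) p. 173] [cite: WeilBNT1967, Ch. II §5] -/
theorem setIntegral_oddShellFibre_eq_scale_sphere_ram (he : v.asIdeal.ramificationIdx' w.1.asIdeal ≠ 1) (h2w : Valued.v (2 : w.1.adicCompletion L) = 1)
    (χ₁ : (LocalRing L v)ˣ →* ℂˣ)
    (l : (LocalRing L v)ˣ) (hlσ : conjLocal L (IsCMField.complexConj L) v (l : LocalRing L v) = l) (hlv : Valued.v ((l : LocalRing L v) w) = WithZero.exp (-2 : ℤ))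
    (hlm : unitModulusChar (LocalRing L v) l = ((Ideal.absNorm v.asIdeal : ℝ≥0) ^ 2)⁻¹)
    {a : LocalRing L v} (ha : conjLocal L (IsCMField.complexConj L) v a = a) (κ : ℕ) (hj : Valued.v (a w) < WithZero.exp (2 * (κ : ℤ) + 1)) :
    ∫ y in {y : ↥(HeisRing.skewPart (conjLocal L (IsCMField.complexConj L) v)) | Valued.v ((a + (y : LocalRing L v)) w) = WithZero.exp (2 * (κ : ℤ) + 1)},
        (fun z : LocalRing L v =>
          if h : IsUnit z then
            ((((χ₁ (Units.map ((conjLocal L (IsCMField.complexConj L) v) : LocalRing L v →* LocalRing L v) h.unit))⁻¹ : ℂˣ) : ℂ) *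
              ((((unitModulusChar (LocalRing L v) h.unit)⁻¹ : ℝ≥0) : ℝ) : ℂ))
          else 0) (a + (y : LocalRing L v)) ∂μY =
      ((χ₁ l : ℂˣ) : ℂ) ^ (κ + 1) * (((Ideal.absNorm v.asIdeal : ℝ) : ℂ)⁻¹) ^ (κ + 1) *
        ∫ s in {s : ↥(HeisRing.skewPart (conjLocal L (IsCMField.complexConj L) v)) | Valued.v ((s : LocalRing L v) w) = WithZero.exp (-1 : ℤ)},
          (fun z : LocalRing L v =>
            if h : IsUnit z then
              ((((χ₁ (Units.map ((conjLocal L (IsCMField.complexConj L) v) : LocalRing L v →* LocalRing L v) h.unit))⁻¹ : ℂˣ) : ℂ) *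
                ((((unitModulusChar (LocalRing L v) h.unit)⁻¹ : ℝ≥0) : ℝ) : ℂ))
            else 0) ((((l ^ (κ + 1) : (LocalRing L v)ˣ)) : LocalRing L v) * a + (s : LocalRing L v)) ∂μY := by
  rw [setIntegral_shellFibre_eq_scale_ram L v w μY χ₁ l hlσ hlv hlm a (2 * κ + 1) (κ + 1)]
  have hexp : (2 * (κ : ℤ) + 1 - 2 * ((κ + 1 : ℕ) : ℤ)) = -1 := by push_cast; ring
  rw [hexp, shellFibre_eq_sphere_of_lt_exp_ram L v w hw he h2w (conjLocal_units_pow_mul_of_fixed L v l hlσ ha (κ + 1))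
    (valued_units_pow_succ_mul_fixed_ram L v w hw he l hlσ hlv ha κ hj).1]
end OddFibre

/-! ## §4 The base of the cut-off shells `a(x) = −(x·σx)·c` (`σc = c`, `|c_w| = 1`; e.g. `c = ⅟2` at a place over an odd prime) -/
/-- `a(x) := −(x·σx)·c` is `σ`-FIXED when `σc = c` (`σσ = 1`). [cite: Rogawski1990, §1.10 p. 9, §12.2 (2) p. 173] -/
theorem conjLocal_neg_mul_conj_mul_of_fixed {c : LocalRing L v} (hcσ : conjLocal L (IsCMField.complexConj L) v c = c) (x : LocalRing L v) :
    conjLocal L (IsCMField.complexConj L) v (-(x * conjLocal L (IsCMField.complexConj L) v x) * c) = -(x * conjLocal L (IsCMField.complexConj L) v x) * c := by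
  rw [map_mul, map_neg, map_mul, conjLocal_conjLocal_cm L v, hcσ, mul_comm (conjLocal L (IsCMField.complexConj L) v x) x]
include hw in
/-- `|a(x)_w| = |x_w|·|x_w|` when `|c_w| = 1` (`|σx|_w = |x|_w` at a place fixed by `c`, ★ `valued_conjLocal_apply_of_smul_eq`). [cite: Rogawski1990, §12.2 (2) p. 173] [cite: WeilBNT1967, Ch. I §2] -/
theorem valued_neg_mul_conj_mul_apply {c : LocalRing L v} (hcw : Valued.v (c w) = 1) (x : LocalRing L v) :
    Valued.v ((-(x * conjLocal L (IsCMField.complexConj L) v x) * c) w) = Valued.v (x w) * Valued.v (x w) := by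
  rw [Pi.mul_apply, Pi.neg_apply, Pi.mul_apply, map_mul, Valuation.map_neg, map_mul, valued_conjLocal_apply_of_smul_eq L v w hw, hcw, mul_one]

end Summit.HodgeConjecture.HodgeConjecture.R90.S1.BposRamShellFibresOdd

end
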